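import Summits.Ventures.HodgeRepro2.T5SU11LegendreLogConvex
import Summits.Ventures.HodgeRepro2.T5SU11JacobiLegendreLeading

/-!
# Turán's inequality `P_{n+1}(x)² ≥ P_n(x) P_{n+2}(x)` on `[−1, 1]`, strict on `(−1, 1)`, and the identity chain
behind it — `n ↦ P_n(x)` is log-concave on `[−1, 1]` and log-convex on `[1, ∞)`: the sign of the Turán determinant
is the sign of `1 − x²`

Row 387 (`T5SU11LegendreLogConvex`) proved the REVERSE inequality `P_{n+1}² ≤ P_n P_{n+2}` on `[1, ∞)` from Laplace's
integral. On `[−1, 1]` the inequality turns around (Turán 1950, Szegő 1948). The proof here is a chain of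
POLYNOMIAL identities between the Turán determinants of the successive derivatives,

  `T_j := (P_{n+1}^{(j)})² − P_n^{(j)} P_{n+2}^{(j)}`   (`turanD n j`, `legD m j = Dʲ legPoly m`):

the two derivative identities `P'_{m+1} = X P'_m + (m + 1) P_m` and `P'_m = X P'_{m+1} − (m + 1) P_{m+1}` (from
`T5SU11SphericalLegendreAll.legendre_identities` / `T5SU11LegendreIdentities.mul_legQ_succ_sub_legQ`, lifted to
`ℝ[X]` through `legP_eq_eval`) differentiate to

  `P_{n+2}^{(j+1)} = X u_{j+1} + (n + 2 + j) u_j`,  `P_n^{(j+1)} = X u_{j+1} − (n + 1 − j) u_j`   (`u_j := P_{n+1}^{(j)}`),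

so every `T_{j+1}` is a quadratic form in `(u_j, u_{j+1})`:

  **`T_{j+1} = (1 − X²) u_{j+1}² − (2j + 1) X u_j u_{j+1} + (n + 1 − j)(n + 2 + j) u_j²`**   (`turanD_succ`);

the `j`-times differentiated Legendre equation `(1 − X²) u_{j+2} − 2(j + 1) X u_{j+1} + ((n+1)(n+2) − j(j+1)) u_j = 0`
(`iterate_legendre_ode`) then gives the chain

  **`((n+1)(n+2) − (j+1) j) · T_{j+1} = (1 − X²) · T_{j+2} + 2(j + 1) · u_{j+1}²`**   (`turanD_chain`),
  **`(n+1)(n+2) · T_0 = (1 − X²) · T_1`**   (`turanD_chain_zero`),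

with `T_{n+1} = (P_{n+1}^{(n+1)})² = ((n+1)! · lc)²` a positive constant (`P_n^{(n+1)} = 0`). Reading the chain downward
from `j = n + 1`, every `T_j` is `≥ 0` on `[−1, 1]` and `> 0` on `(−1, 1)` — the Turán inequality for the derivatives
(the ultraspherical polynomials `C^{(j+1/2)}`) at the same time — and at `j = 0`:

  **`P_n(x) P_{n+2}(x) ≤ P_{n+1}(x)²` for `x ∈ [−1, 1]`**, **`<` for `x ∈ (−1, 1)`**, **`=` at `x = ±1`**
  (`turan`, `turan_lt`, `turan_eq_one`, `turan_eq_neg_one`),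

and, joined with row 387 and the parity `P_m(−x) = (−1)^m P_m(x)`, the sign law on the whole line

  **`0 ≤ (1 − x²) · (P_{n+1}(x)² − P_n(x) P_{n+2}(x))` for every real `x`**   (`one_sub_sq_mul_turan_nonneg`).

Nothing is claimed about (N).

Blind lane: Mathlib + the HodgeRepro2 prefix only; no sorry; axioms ⊆ {propext, Classical.choice,
Quot.sound}.
-/

namespace Summit.Ventures.HodgeRepro2.T5SU11LegendreTuran

open Polynomial Set
open T5SU11SphericalLegendreAll T5SU11SphericalLegendreLaplace T5SU11LegendreIdentities T5SU11LegendreLogConvex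
  T5SU11JacobiPhaseLawEven T5SU11JacobiLegendreLeading

/-! ### The derivatives of `legPoly` evaluate to `legQ`, `legR` -/

/-- **`(D legPoly n)(x) = P'_n(x)`.** -/
theorem eval_derivative_legPoly (n : ℕ) (x : ℝ) : (derivative (legPoly n)).eval x = legQ n x := by
  have h1 : HasDerivAt (fun y => (legPoly n).eval y) ((derivative (legPoly n)).eval x) x :=
    (legPoly n).hasDerivAt x
  have h2 : HasDerivAt (fun y => (legPoly n).eval y) (legQ n x) x :=
    (hasDerivAt_legP n x).congr_of_eventuallyEq (Filter.Eventually.of_forall fun y => (legP_eq_eval n y).symm)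
  exact h1.unique h2

/-- **`(D² legPoly n)(x) = P''_n(x)`.** -/
theorem eval_derivative_derivative_legPoly (n : ℕ) (x : ℝ) :
    (derivative (derivative (legPoly n))).eval x = legR n x := by
  have h1 : HasDerivAt (fun y => (derivative (legPoly n)).eval y)
      ((derivative (derivative (legPoly n))).eval x) x :=
    (derivative (legPoly n)).hasDerivAt x
  have h2 : HasDerivAt (fun y => (derivative (legPoly n)).eval y) (legR n x) x :=
    (hasDerivAt_legQ n x).congr_of_eventuallyEq (Filter.Eventually.of_forall fun y => eval_derivative_legPoly n y)
  exact h1.unique h2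

/-! ### The derivative identities and Legendre's equation as polynomial identities -/

/-- **`P'_{n+1} = X P'_n + (n + 1) P_n`** in `ℝ[X]`. -/
theorem derivative_legPoly_succ (n : ℕ) :
    derivative (legPoly (n + 1)) = X * derivative (legPoly n) + ((n : ℝ[X]) + 1) * legPoly n := by
  apply Polynomial.funext
  intro r
  simp only [eval_add, eval_mul, eval_X, eval_natCast, eval_one, eval_derivative_legPoly, ← legP_eq_eval]
  exact (legendre_identities n r).1

/-- **`P'_n = X P'_{n+1} − (n + 1) P_{n+1}`** in `ℝ[X]`. -/
theorem derivative_legPoly_eq_sub (n : ℕ) :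
    derivative (legPoly n) = X * derivative (legPoly (n + 1)) - ((n : ℝ[X]) + 1) * legPoly (n + 1) := by
  apply Polynomial.funext
  intro r
  simp only [eval_sub, eval_add, eval_mul, eval_X, eval_natCast, eval_one, eval_derivative_legPoly, ← legP_eq_eval]
  linear_combination (-1 : ℝ) * mul_legQ_succ_sub_legQ n r

/-- **`(n + 1) P_{n+1} = (n + 1) X P_n − (1 − X²) P'_n`** in `ℝ[X]`. -/
theorem legPoly_succ_eq (n : ℕ) :
    ((n : ℝ[X]) + 1) * legPoly (n + 1)
      = ((n : ℝ[X]) + 1) * X * legPoly n - (1 - X ^ 2) * derivative (legPoly n) := by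
  apply Polynomial.funext
  intro r
  simp only [eval_sub, eval_add, eval_mul, eval_X, eval_natCast, eval_one, eval_pow, eval_derivative_legPoly,
    ← legP_eq_eval]
  linear_combination (-1 : ℝ) * (legendre_identities n r).2

/-- **`(n + 1) P_n = (n + 1) X P_{n+1} + (1 − X²) P'_{n+1}`** in `ℝ[X]`. -/
theorem legPoly_eq_succ (n : ℕ) :
    ((n : ℝ[X]) + 1) * legPoly n
      = ((n : ℝ[X]) + 1) * X * legPoly (n + 1) + (1 - X ^ 2) * derivative (legPoly (n + 1)) := by
  apply Polynomial.funext
  intro r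
  simp only [eval_sub, eval_add, eval_mul, eval_X, eval_natCast, eval_one, eval_pow, eval_derivative_legPoly,
    ← legP_eq_eval]
  have h1 := (legendre_identities n r).1
  have h2 := mul_legQ_succ_sub_legQ n r
  linear_combination r * h2 - h1

/-- **Legendre's equation in `ℝ[X]`**: `(1 − X²) P''_n − 2X P'_n + n(n + 1) P_n = 0`. -/
theorem legendre_ode_poly (n : ℕ) :
    (1 - X ^ 2) * derivative (derivative (legPoly n)) - 2 * X * derivative (legPoly n)
      + (n : ℝ[X]) * ((n : ℝ[X]) + 1) * legPoly n = 0 := by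
  apply Polynomial.funext
  intro r
  simp only [eval_sub, eval_add, eval_mul, eval_X, eval_natCast, eval_one, eval_pow, eval_zero, eval_ofNat,
    eval_derivative_derivative_legPoly, eval_derivative_legPoly, ← legP_eq_eval]
  linear_combination (-1 : ℝ) * legendre_ode n r

/-! ### The iterated derivatives `legD m j = Dʲ legPoly m` -/

/-- **`legD m j = P_m^{(j)}`**, the `j`-th derivative of the `m`-th Legendre polynomial. -/
noncomputable def legD (m j : ℕ) : ℝ[X] := derivative^[j] (legPoly m)

/-- `legD m 0 = legPoly m`. -/
@[simp] lemma legD_zero (m : ℕ) : legD m 0 = legPoly m := rfl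

/-- `legD m (j + 1) = D (legD m j)`. -/
lemma legD_succ (m j : ℕ) : legD m (j + 1) = derivative (legD m j) := Function.iterate_succ_apply' _ _ _

/-- `legD m 1 = D (legPoly m)`. -/
lemma legD_one (m : ℕ) : legD m 1 = derivative (legPoly m) := by rw [legD_succ, legD_zero]

/-- **`P_m^{(m+1)} = 0`.** -/
theorem legD_succ_self (m : ℕ) : legD m (m + 1) = 0 :=
  iterate_derivative_eq_zero (by rw [natDegree_legPoly]; exact Nat.lt_succ_self m)

/-- **`P_m^{(m)} = m! · lc(P_m)`**, a constant. -/
theorem legD_self (m : ℕ) : legD m m = C ((m.factorial : ℝ) * legLead m) := by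
  have hdeg : (legD m m).natDegree ≤ 0 := by
    have := natDegree_iterate_derivative (legPoly m) m
    rwa [natDegree_legPoly, Nat.sub_self] at this
  rw [eq_C_of_natDegree_le_zero hdeg]
  congr 1
  show (derivative^[m] (legPoly m)).coeff 0 = _
  rw [coeff_iterate_derivative, zero_add, Nat.descFactorial_self, coeff_legPoly_self, nsmul_eq_mul]

/-- **`P_m^{(m)}(x) = m! · lc(P_m) > 0`.** -/
theorem eval_legD_self_pos (m : ℕ) (x : ℝ) : 0 < (legD m m).eval x := by
  rw [legD_self, eval_C]
  exact mul_pos (by exact_mod_cast m.factorial_pos) (legLead_pos m)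

/-- **The iterated Legendre equation**
`(1 − X²) P_m^{(j+2)} − 2(j + 1) X P_m^{(j+1)} + (m(m + 1) − j(j + 1)) P_m^{(j)} = 0` for every `j`. -/
theorem iterate_legendre_ode (m j : ℕ) :
    (1 - X ^ 2) * legD m (j + 2) - 2 * ((j : ℝ[X]) + 1) * X * legD m (j + 1)
      + ((m : ℝ[X]) * ((m : ℝ[X]) + 1) - (j : ℝ[X]) * ((j : ℝ[X]) + 1)) * legD m j = 0 := by
  induction j with
  | zero =>
    rw [show (0 : ℕ) + 2 = 1 + 1 from rfl, legD_succ, legD_one, legD_zero]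
    simp only [Nat.cast_zero, zero_add, mul_one, sub_zero]
    linear_combination legendre_ode_poly m
  | succ j ih =>
    have hd := congrArg derivative ih
    simp only [derivative_add, derivative_sub, derivative_mul, derivative_X, derivative_one, derivative_X_sq,
      derivative_natCast, derivative_ofNat, derivative_zero, ← legD_succ, C_ofNat] at hd
    rw [show j + 1 + 2 = j + 2 + 1 by ring]
    push_cast
    linear_combination hd

/-- **`P_{n+2}^{(j+1)} = X P_{n+1}^{(j+1)} + (n + 2 + j) P_{n+1}^{(j)}`.** -/
theorem legD_succ_succ_eq (n j : ℕ) :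
    legD (n + 2) (j + 1) = X * legD (n + 1) (j + 1) + ((n : ℝ[X]) + 2 + (j : ℝ[X])) * legD (n + 1) j := by
  induction j with
  | zero =>
    rw [legD_one, legD_one, legD_zero, derivative_legPoly_succ (n + 1)]
    push_cast
    ring
  | succ j ih =>
    rw [legD_succ, ih, derivative_add, derivative_mul, derivative_mul, derivative_X, ← legD_succ, ← legD_succ]
    simp only [derivative_add, derivative_natCast, derivative_ofNat]
    push_cast
    ring

/-- **`P_n^{(j+1)} = X P_{n+1}^{(j+1)} − (n + 1 − j) P_{n+1}^{(j)}`.** -/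
theorem legD_eq_succ (n j : ℕ) :
    legD n (j + 1) = X * legD (n + 1) (j + 1) - ((n : ℝ[X]) + 1 - (j : ℝ[X])) * legD (n + 1) j := by
  induction j with
  | zero =>
    rw [legD_one, legD_one, legD_zero, derivative_legPoly_eq_sub n]
    push_cast
    ring
  | succ j ih =>
    rw [legD_succ, ih, derivative_sub, derivative_mul, derivative_mul, derivative_X, ← legD_succ, ← legD_succ]
    simp only [derivative_sub, derivative_add, derivative_natCast, derivative_one]
    push_cast
    ring

/-! ### The Turán determinants of the derivatives and the identity chain -/

/-- **The Turán determinant of the `j`-th derivatives**, `T_j = (P_{n+1}^{(j)})² − P_n^{(j)} P_{n+2}^{(j)}`. -/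
noncomputable def turanD (n j : ℕ) : ℝ[X] := legD (n + 1) j ^ 2 - legD n j * legD (n + 2) j

/-- `T_0 = P_{n+1}² − P_n P_{n+2}`. -/
theorem turanD_zero (n : ℕ) : turanD n 0 = legPoly (n + 1) ^ 2 - legPoly n * legPoly (n + 2) := rfl

/-- **`T_{j+1}` is a quadratic form in `u_j = P_{n+1}^{(j)}`, `u_{j+1}`**:
`T_{j+1} = (1 − X²) u_{j+1}² − (2j + 1) X u_j u_{j+1} + (n + 1 − j)(n + 2 + j) u_j²`. -/
theorem turanD_succ (n j : ℕ) :
    turanD n (j + 1) = (1 - X ^ 2) * legD (n + 1) (j + 1) ^ 2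
      - (2 * (j : ℝ[X]) + 1) * X * legD (n + 1) j * legD (n + 1) (j + 1)
      + ((n : ℝ[X]) + 1 - (j : ℝ[X])) * ((n : ℝ[X]) + 2 + (j : ℝ[X])) * legD (n + 1) j ^ 2 := by
  rw [turanD, legD_succ_succ_eq n j, legD_eq_succ n j]
  ring

/-- **`T_{n+1} = (P_{n+1}^{(n+1)})²`**, since `P_n^{(n+1)} = 0`. -/
theorem turanD_top (n : ℕ) : turanD n (n + 1) = legD (n + 1) (n + 1) ^ 2 := by
  rw [turanD, legD_succ_self, zero_mul, sub_zero]

/-- **The chain at `j = 0`**: `(n + 1)(n + 2) · T_0 = (1 − X²) · T_1`. -/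
theorem turanD_chain_zero (n : ℕ) :
    ((n : ℝ[X]) + 1) * ((n : ℝ[X]) + 2) * turanD n 0 = (1 - X ^ 2) * turanD n 1 := by
  rw [turanD_succ, turanD_zero, legD_one, legD_zero]
  have hA := legPoly_eq_succ n
  have hB := legPoly_succ_eq (n + 1)
  push_cast at hB
  simp only [Nat.cast_zero, add_zero, sub_zero, mul_zero, zero_add]
  linear_combination (-(((n : ℝ[X]) + 1 + 1) * legPoly (n + 2))) * hA
    - (((n : ℝ[X]) + 1) * X * legPoly (n + 1) + (1 - X ^ 2) * derivative (legPoly (n + 1))) * hB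

/-- **The chain**: `((n+1)(n+2) − (j+1) j) · T_{j+1} = (1 − X²) · T_{j+2} + 2(j + 1) · (P_{n+1}^{(j+1)})²`. -/
theorem turanD_chain (n j : ℕ) :
    (((n : ℝ[X]) + 1) * ((n : ℝ[X]) + 2) - ((j : ℝ[X]) + 1) * (j : ℝ[X])) * turanD n (j + 1)
      = (1 - X ^ 2) * turanD n (j + 2) + 2 * ((j : ℝ[X]) + 1) * legD (n + 1) (j + 1) ^ 2 := by
  have h := iterate_legendre_ode (n + 1) j
  push_cast at h
  rw [show j + 2 = j + 1 + 1 from rfl, turanD_succ, turanD_succ]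
  push_cast
  linear_combination ((2 * (j : ℝ[X]) + 3) * X * legD (n + 1) (j + 1)
    - ((1 - X ^ 2) * legD (n + 1) (j + 2) + (2 * ((j : ℝ[X]) + 1) * X * legD (n + 1) (j + 1)
      - (((n : ℝ[X]) + 1) * ((n : ℝ[X]) + 1 + 1) - (j : ℝ[X]) * ((j : ℝ[X]) + 1)) * legD (n + 1) j))) * h

/-! ### Positivity: reading the chain downward -/

/-- `(n+1)(n+2) − (j+1) j > 0` for `j ≤ n`. -/
theorem chain_coeff_pos {n j : ℕ} (hj : j ≤ n) :
    0 < ((n : ℝ) + 1) * ((n : ℝ) + 2) - ((j : ℝ) + 1) * (j : ℝ) := by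
  have hjn : (j : ℝ) ≤ n := by exact_mod_cast hj
  nlinarith [hjn, (Nat.cast_nonneg j : (0 : ℝ) ≤ j)]

/-- **The Turán determinants of all derivatives are `≥ 0` on `[−1, 1]`**: `T_j(x) ≥ 0` for `j ≤ n + 1`. -/
theorem eval_turanD_nonneg (n : ℕ) {x : ℝ} (hx : x ∈ Icc (-1 : ℝ) 1) :
    ∀ j, j ≤ n + 1 → 0 ≤ (turanD n j).eval x := by
  have h1x : 0 ≤ 1 - x ^ 2 := by nlinarith [hx.1, hx.2]
  suffices H : ∀ k j, j + k = n + 1 → 0 ≤ (turanD n j).eval x by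
    intro j hj
    exact H (n + 1 - j) j (by omega)
  intro k
  induction k with
  | zero =>
    intro j hj
    rw [add_zero] at hj
    subst hj
    rw [turanD_top, eval_pow]
    positivity
  | succ k ih =>
    intro j hj
    have ih' := ih (j + 1) (by omega)
    rcases j with _ | j
    · have h := congrArg (eval x) (turanD_chain_zero n)
      simp only [eval_mul, eval_add, eval_sub, eval_pow, eval_one, eval_X, eval_natCast, eval_ofNat] at h
      have hpos : 0 < ((n : ℝ) + 1) * ((n : ℝ) + 2) := by positivity
      have : 0 ≤ ((n : ℝ) + 1) * ((n : ℝ) + 2) * (turanD n 0).eval x := by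
        rw [h]; exact mul_nonneg h1x ih'
      exact nonneg_of_mul_nonneg_right this hpos
    · have h := congrArg (eval x) (turanD_chain n j)
      simp only [eval_mul, eval_add, eval_sub, eval_pow, eval_one, eval_X, eval_natCast, eval_ofNat] at h
      have hpos := chain_coeff_pos (n := n) (j := j) (by omega)
      have : 0 ≤ (((n : ℝ) + 1) * ((n : ℝ) + 2) - ((j : ℝ) + 1) * (j : ℝ)) * (turanD n (j + 1)).eval x := by
        rw [h]
        have : 0 ≤ 2 * ((j : ℝ) + 1) * (legD (n + 1) (j + 1)).eval x ^ 2 := by positivity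
        exact add_nonneg (mul_nonneg h1x ih') this
      exact nonneg_of_mul_nonneg_right this hpos

/-- **The Turán determinants of all derivatives are `> 0` on `(−1, 1)`**: `T_j(x) > 0` for `j ≤ n + 1`. -/
theorem eval_turanD_pos (n : ℕ) {x : ℝ} (hx : x ∈ Ioo (-1 : ℝ) 1) :
    ∀ j, j ≤ n + 1 → 0 < (turanD n j).eval x := by
  have h1x : 0 < 1 - x ^ 2 := by nlinarith [hx.1, hx.2]
  suffices H : ∀ k j, j + k = n + 1 → 0 < (turanD n j).eval x by
    intro j hj
    exact H (n + 1 - j) j (by omega)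
  intro k
  induction k with
  | zero =>
    intro j hj
    rw [add_zero] at hj
    subst hj
    rw [turanD_top, eval_pow]
    exact pow_pos (eval_legD_self_pos (n + 1) x) 2
  | succ k ih =>
    intro j hj
    have ih' := ih (j + 1) (by omega)
    rcases j with _ | j
    · have h := congrArg (eval x) (turanD_chain_zero n)
      simp only [eval_mul, eval_add, eval_sub, eval_pow, eval_one, eval_X, eval_natCast, eval_ofNat] at h
      have hpos : 0 < ((n : ℝ) + 1) * ((n : ℝ) + 2) := by positivity
      have : 0 < ((n : ℝ) + 1) * ((n : ℝ) + 2) * (turanD n 0).eval x := by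
        rw [h]; exact mul_pos h1x ih'
      exact pos_of_mul_pos_right this hpos.le
    · have h := congrArg (eval x) (turanD_chain n j)
      simp only [eval_mul, eval_add, eval_sub, eval_pow, eval_one, eval_X, eval_natCast, eval_ofNat] at h
      have hpos := chain_coeff_pos (n := n) (j := j) (by omega)
      have : 0 < (((n : ℝ) + 1) * ((n : ℝ) + 2) - ((j : ℝ) + 1) * (j : ℝ)) * (turanD n (j + 1)).eval x := by
        rw [h]
        have : 0 ≤ 2 * ((j : ℝ) + 1) * (legD (n + 1) (j + 1)).eval x ^ 2 := by positivity
        exact add_pos_of_pos_of_nonneg (mul_pos h1x ih') this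
      exact pos_of_mul_pos_right this hpos.le

/-! ### Turán's inequality -/

/-- `T_0(x) = P_{n+1}(x)² − P_n(x) P_{n+2}(x)`. -/
theorem eval_turanD_zero (n : ℕ) (x : ℝ) :
    (turanD n 0).eval x = legP (n + 1) x ^ 2 - legP n x * legP (n + 2) x := by
  rw [turanD_zero, eval_sub, eval_pow, eval_mul, ← legP_eq_eval, ← legP_eq_eval, ← legP_eq_eval]

/-- **TURÁN'S INEQUALITY**: `P_n(x) P_{n+2}(x) ≤ P_{n+1}(x)²` for `x ∈ [−1, 1]`. -/
theorem turan (n : ℕ) {x : ℝ} (hx : x ∈ Icc (-1 : ℝ) 1) : legP n x * legP (n + 2) x ≤ legP (n + 1) x ^ 2 := by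
  have h := eval_turanD_nonneg n hx 0 (Nat.zero_le _)
  rw [eval_turanD_zero] at h
  linarith

/-- **Turán's inequality is strict on `(−1, 1)`**: `P_n(x) P_{n+2}(x) < P_{n+1}(x)²`. -/
theorem turan_lt (n : ℕ) {x : ℝ} (hx : x ∈ Ioo (-1 : ℝ) 1) : legP n x * legP (n + 2) x < legP (n + 1) x ^ 2 := by
  have h := eval_turanD_pos n hx 0 (Nat.zero_le _)
  rw [eval_turanD_zero] at h
  linarith

/-- **Equality at `x = 1`.** -/
theorem turan_eq_one (n : ℕ) : legP n 1 * legP (n + 2) 1 = legP (n + 1) 1 ^ 2 := by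
  simp only [legP_one]; norm_num

/-- **Equality at `x = −1`.** -/
theorem turan_eq_neg_one (n : ℕ) : legP n (-1) * legP (n + 2) (-1) = legP (n + 1) (-1) ^ 2 := by
  simp only [legP_neg_one]
  rw [← pow_add, ← pow_mul, show n + (n + 2) = 2 * (n + 1) by ring, show (n + 1) * 2 = 2 * (n + 1) by ring]

/-- **The Turán determinant is even in `x`**: `P_{n+1}(−x)² − P_n(−x) P_{n+2}(−x) = P_{n+1}(x)² − P_n(x) P_{n+2}(x)`. -/
theorem turan_det_neg (n : ℕ) (x : ℝ) :
    legP (n + 1) (-x) ^ 2 - legP n (-x) * legP (n + 2) (-x) = legP (n + 1) x ^ 2 - legP n x * legP (n + 2) x := by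
  rw [legP_neg, legP_neg, legP_neg]
  have h1 : ((-1 : ℝ) ^ (n + 1)) ^ 2 = 1 := by
    rw [← pow_mul, show (n + 1) * 2 = 2 * (n + 1) by ring, pow_mul, neg_one_sq, one_pow]
  have h2 : (-1 : ℝ) ^ n * (-1) ^ (n + 2) = 1 := by
    rw [← pow_add, show n + (n + 2) = 2 * (n + 1) by ring, pow_mul, neg_one_sq, one_pow]
  linear_combination (legP (n + 1) x ^ 2) * h1 - (legP n x * legP (n + 2) x) * h2

/-- **The sign law on the whole line**: `0 ≤ (1 − x²)(P_{n+1}(x)² − P_n(x) P_{n+2}(x))` for every real `x` —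
log-concave on `[−1, 1]` (Turán), log-convex outside (row 387 and parity). -/
theorem one_sub_sq_mul_turan_nonneg (n : ℕ) (x : ℝ) :
    0 ≤ (1 - x ^ 2) * (legP (n + 1) x ^ 2 - legP n x * legP (n + 2) x) := by
  letI : MeasurableSpace Circle := borel Circle
  haveI : BorelSpace Circle := ⟨rfl⟩
  rcases le_or_gt x (-1) with hx | hx
  · -- `x ≤ −1`: parity and row 387 at `−x ≥ 1`
    have h := legP_sq_le_mul n (x := -x) (by linarith)
    rw [← turan_det_neg]
    have h1 : 1 - x ^ 2 ≤ 0 := by nlinarith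
    exact mul_nonneg_of_nonpos_of_nonpos h1 (by linarith)
  rcases le_or_gt x 1 with hx' | hx'
  · have h := turan n ⟨hx.le, hx'⟩
    have h1 : 0 ≤ 1 - x ^ 2 := by nlinarith
    exact mul_nonneg h1 (by linarith)
  · have h := legP_sq_le_mul n hx'.le
    have h1 : 1 - x ^ 2 ≤ 0 := by nlinarith
    exact mul_nonneg_of_nonpos_of_nonpos h1 (by linarith)

/-- **Turán for the derivatives** (the ultraspherical polynomials `C^{(j+1/2)}`):
`P_n^{(j)}(x) P_{n+2}^{(j)}(x) ≤ (P_{n+1}^{(j)}(x))²` on `[−1, 1]` for every `j ≤ n + 1`. -/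
theorem turan_derivative (n : ℕ) {j : ℕ} (hj : j ≤ n + 1) {x : ℝ} (hx : x ∈ Icc (-1 : ℝ) 1) :
    (legD n j).eval x * (legD (n + 2) j).eval x ≤ (legD (n + 1) j).eval x ^ 2 := by
  have h := eval_turanD_nonneg n hx j hj
  rw [turanD, eval_sub, eval_pow, eval_mul] at h
  linarith

end Summit.Ventures.HodgeRepro2.T5SU11LegendreTuran
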